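import Summits.QuantumFields.YangMills.Theorems.DirichletWindowAllSidesChessboardEvenFamilies
import Summits.QuantumFields.YangMills.Theorems.DirichletWindowAllSidesChessboardEvenWeightedRP
import HarnessLib

/-!
# Plaquette sets of ALL orientations on the even torus — the LINK and SITE Schwarz inequalities of the axis `0`

Support file for item stmt-QuantumFields-20194 (`DirichletWindow.AllSidesCouplingChessboard`, K1 of the large-field
sparsity line; seat ym-dw-p1 g3).

For the Chebyshev functional `Ψ(A) = ⟨exp(c ∑_{q ∈ plaqsE A} φ_q)⟩_{Λ,β}` of a family of corner patterns on the even
torus `(ℤ/L)^d` (`L = 2m`, `0 ≤ c ≤ β`), this file proves the two reflection Cauchy–Schwarz inequalities of the axis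
`0` needed by the abstract even estimate `twisted_chessboard_le_rpow_even_of_base`:

* LINK (`mpsiE_link_sq_le_zero`): `Ψ(A)² ≤ Ψ(L⁺A) Ψ(L⁻A)` for the Osterwalder–Seiler link reflection between the slices
  `0 | 1` and `m | m+1`, which symmetrises transverse components with the OPEN symmetrisations `symP/symM 0 1` and
  in-plane components with the site-type CLOSED symmetrisations `ssymP/ssymM 0 0` (the two cut slabs are kept once and
  weighted — `sq_wilsonExpectation_mul_timeReflect_mul_expObs_le_even`);
* SITE (`mpsiE_site_sq_le_zero`): `Ψ(A)² ≤ Ψ(S⁺A) Ψ(S⁻A)` for the site reflection through the slices `0` and `m`, with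
  `ssymP/ssymM 0 0` on transverse components (the two shared layers, `Θ'`-invariant functions of the shared links,
  are absorbed into both factors) and `symP/symM 0 0` on in-plane components (`sq_integral_mul_negReflect_le`).

HONEST FRAMING: finite-torus reflection-positivity bookkeeping; no claim about the mass gap or infinite volume.
References: Fröhlich–Israel–Lieb–Simon, CMP 62 (1978) Thm. 4.1; Osterwalder–Seiler, Ann. Phys. 110 (1978) §2.
-/

noncomputable section

open MeasureTheory Finset
open Literature.MathematicalPhysics.QuantumFieldTheory
open Literature.MathematicalPhysics.QuantumFieldTheory.WilsonRP
open Literature.MathematicalPhysics.QuantumFieldTheory.WilsonSiteRP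
open Literature.Barriers.CriticalPhenomena.NonGibbs
open Literature.Probability.LatticeModels
open Summit.QuantumFields.YangMills.Theorems.SoloBlind
open Summit.QuantumFields.YangMills.Theorems.OddTorusChessboard

namespace Summit.QuantumFields.YangMills.Theorems.AllSidesChessboard

variable {d L N : ℕ} [NeZero d] [NeZero L] {G : Type*} [Group G] [TopologicalSpace G]
  [IsTopologicalGroup G] [CompactSpace G] [MeasurableSpace G] [BorelSpace G]
  (ρ : G →* Matrix (Fin N) (Fin N) ℂ)

/-! ### §1. Row decompositions of a pattern along the axis `0` -/

section Rows

/-- Site-type decomposition: the non-fixed part of the closed positive half-line. -/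
def sRowsX (j : ZMod L) (B : Finset (BlockIdx d L)) : Finset (BlockIdx d L) := (B ∩ shalfP L 0 j) \ shalfM L 0 j

/-- Site-type decomposition: the fixed part. -/
def sRowsF (j : ZMod L) (B : Finset (BlockIdx d L)) : Finset (BlockIdx d L) := B ∩ shalfP L 0 j ∩ shalfM L 0 j

/-- Site-type decomposition: the complement of the closed positive half-line. -/
def sRowsY (j : ZMod L) (B : Finset (BlockIdx d L)) : Finset (BlockIdx d L) := B \ shalfP L 0 j

/-- A non-fixed block of the positive half-line reflects out of the positive half-line (even `L`). -/
theorem sreflect_not_mem_shalfP (hL : Even L) {j : ZMod L} {c : BlockIdx d L} (_hP : c ∈ shalfP L 0 j)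
    (hM : c ∉ shalfM L 0 j) : sreflect 0 j c ∉ shalfP L 0 j := fun h =>
  hM (by
    have h' := sreflect_mem_shalfM hL h
    rwa [sreflect_sreflect] at h')

/-- **The site-type symmetrisations in terms of the decomposition** (even `L`):
`B = X ∪ F ∪ Y`, `ssymP = X ∪ F ∪ θX`, `ssymM = θY ∪ F ∪ Y`, with the disjointness needed downstream. -/
theorem sRows_facts (hL : Even L) (j : ZMod L) (B : Finset (BlockIdx d L)) :
    B = sRowsX j B ∪ sRowsF j B ∪ sRowsY j B ∧
    ssymP 0 j B = sRowsX j B ∪ sRowsF j B ∪ (sRowsX j B).image (sreflect 0 j) ∧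
    ssymM 0 j B = (sRowsY j B).image (sreflect 0 j) ∪ sRowsF j B ∪ sRowsY j B ∧
    Disjoint (sRowsX j B) (sRowsF j B) ∧ Disjoint (sRowsX j B ∪ sRowsF j B) (sRowsY j B) ∧
    Disjoint (sRowsX j B ∪ sRowsF j B) ((sRowsX j B).image (sreflect 0 j)) ∧
    Disjoint ((sRowsY j B).image (sreflect 0 j) ∪ sRowsF j B) (sRowsY j B) ∧
    Disjoint ((sRowsY j B).image (sreflect 0 j)) (sRowsF j B) := by
  have hfix : ∀ c ∈ sRowsF j B, sreflect 0 j c = c := fun c hc => by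
    simp only [sRowsF, mem_inter] at hc
    exact sreflect_eq_self_of_mem_mem hL hc.1.2 hc.2
  refine ⟨?_, ?_, ?_, ?_, ?_, ?_, ?_, ?_⟩
  · ext c
    simp only [sRowsX, sRowsF, sRowsY, mem_union, mem_sdiff, mem_inter]
    have := mem_shalfP_or_mem_shalfM 0 j c
    tauto
  · ext c
    simp only [ssymP, sRowsX, sRowsF, mem_union, mem_inter, mem_image, mem_sdiff]
    constructor
    · rintro (⟨hcB, hcP⟩ | ⟨b, ⟨hbB, hbP⟩, rfl⟩)
      · by_cases hM : c ∈ shalfM L 0 j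
        · exact Or.inl (Or.inr ⟨⟨hcB, hcP⟩, hM⟩)
        · exact Or.inl (Or.inl ⟨⟨hcB, hcP⟩, hM⟩)
      · by_cases hM : b ∈ shalfM L 0 j
        · rw [sreflect_eq_self_of_mem_mem hL hbP hM]
          exact Or.inl (Or.inr ⟨⟨hbB, hbP⟩, hM⟩)
        · exact Or.inr ⟨b, ⟨⟨hbB, hbP⟩, hM⟩, rfl⟩
    · rintro ((⟨⟨hcB, hcP⟩, -⟩ | ⟨⟨hcB, hcP⟩, -⟩) | ⟨b, ⟨⟨hbB, hbP⟩, -⟩, rfl⟩)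
      · exact Or.inl ⟨hcB, hcP⟩
      · exact Or.inl ⟨hcB, hcP⟩
      · exact Or.inr ⟨b, ⟨hbB, hbP⟩, rfl⟩
  · ext c
    simp only [ssymM, sRowsY, sRowsF, mem_union, mem_inter, mem_image, mem_sdiff]
    constructor
    · rintro (⟨hcB, hcM⟩ | ⟨b, ⟨hbB, hbM⟩, rfl⟩)
      · by_cases hP : c ∈ shalfP L 0 j
        · exact Or.inl (Or.inr ⟨⟨hcB, hP⟩, hcM⟩)
        · exact Or.inr ⟨hcB, hP⟩
      · by_cases hP : b ∈ shalfP L 0 j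
        · rw [sreflect_eq_self_of_mem_mem hL hP hbM]
          exact Or.inl (Or.inr ⟨⟨hbB, hP⟩, hbM⟩)
        · exact Or.inl (Or.inl ⟨b, ⟨hbB, hP⟩, rfl⟩)
    · rintro ((⟨b, ⟨hbB, hbP⟩, rfl⟩ | ⟨⟨hcB, -⟩, hcM⟩) | ⟨hcB, hcP⟩)
      · have hbM : b ∈ shalfM L 0 j := (mem_shalfP_or_mem_shalfM 0 j b).resolve_left hbP
        exact Or.inr ⟨b, ⟨hbB, hbM⟩, rfl⟩
      · exact Or.inl ⟨hcB, hcM⟩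
      · exact Or.inl ⟨hcB, (mem_shalfP_or_mem_shalfM 0 j c).resolve_left hcP⟩
  · rw [Finset.disjoint_left]
    simp only [sRowsX, sRowsF, mem_sdiff, mem_inter]
    tauto
  · rw [Finset.disjoint_left]
    simp only [sRowsX, sRowsF, sRowsY, mem_union, mem_sdiff, mem_inter]
    tauto
  · rw [Finset.disjoint_left]
    simp only [sRowsX, sRowsF, mem_union, mem_sdiff, mem_inter, mem_image]
    rintro c hc ⟨b, ⟨⟨hbB, hbP⟩, hbM⟩, rfl⟩
    have hnot := sreflect_not_mem_shalfP hL hbP hbM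
    tauto
  · rw [Finset.disjoint_left]
    simp only [sRowsF, sRowsY, mem_union, mem_sdiff, mem_inter, mem_image]
    rintro c (⟨b, ⟨hbB, hbP⟩, rfl⟩ | ⟨⟨hcB, hcP⟩, hcM⟩) ⟨-, hnP⟩
    · exact hnP (sreflect_mem_shalfP hL ((mem_shalfP_or_mem_shalfM 0 j b).resolve_left hbP))
    · exact hnP hcP
  · rw [Finset.disjoint_left]
    simp only [sRowsF, sRowsY, mem_sdiff, mem_inter, mem_image]
    rintro c ⟨b, ⟨hbB, hbP⟩, rfl⟩ ⟨⟨-, hP⟩, hM⟩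
    have h := sreflect_eq_self_of_mem_mem hL hP hM
    rw [sreflect_sreflect] at h
    exact hbP (by rw [h]; exact hP)

/-- **The open symmetrisations in terms of the half-lines** (even `L`): with `X = B ∩ H₊`, `Y = B ∩ H₋`:
`B = X ∪ ∅ ∪ Y`, `symP = X ∪ ∅ ∪ θX`, `symM = θY ∪ ∅ ∪ Y`, and the disjointness needed downstream. -/
theorem oRows_facts (hL : Even L) (k : ZMod L) (B : Finset (BlockIdx d L)) :
    B = (B ∩ halfPlus L 0 k) ∪ ∅ ∪ (B ∩ halfMinus L 0 k) ∧
    symP 0 k B = (B ∩ halfPlus L 0 k) ∪ ∅ ∪ (B ∩ halfPlus L 0 k).image (cellReflect 0 k) ∧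
    symM 0 k B = (B ∩ halfMinus L 0 k).image (cellReflect 0 k) ∪ ∅ ∪ (B ∩ halfMinus L 0 k) ∧
    Disjoint (B ∩ halfPlus L 0 k) ∅ ∧ Disjoint (B ∩ halfPlus L 0 k ∪ ∅) (B ∩ halfMinus L 0 k) ∧
    Disjoint (B ∩ halfPlus L 0 k ∪ ∅) ((B ∩ halfPlus L 0 k).image (cellReflect 0 k)) ∧
    Disjoint ((B ∩ halfMinus L 0 k).image (cellReflect 0 k) ∪ ∅) (B ∩ halfMinus L 0 k) ∧
    Disjoint ((B ∩ halfMinus L 0 k).image (cellReflect 0 k)) ∅ := by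
  have hd := disjoint_halfPlus_halfMinus (N := L) (d := d) 0 k
  refine ⟨?_, ?_, ?_, disjoint_empty_right _, ?_, ?_, ?_, disjoint_empty_right _⟩
  · rw [union_empty, ← inter_union_distrib_left]
    exact (inter_eq_left.2 fun c _ => mem_union.2 (mem_halfPlus_or_mem_halfMinus 0 k c)).symm
  · rw [union_empty]; rfl
  · rw [union_empty, symM, union_comm]
  · rw [union_empty]; exact hd.mono inter_subset_right inter_subset_right
  · rw [union_empty, Finset.disjoint_left]
    rintro c hc hc'
    obtain ⟨b, hb, rfl⟩ := mem_image.1 hc'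
    exact Finset.disjoint_left.1 hd (mem_inter.1 hc).2 (cellReflect_mem_halfMinus hL (mem_inter.1 hb).2)
  · rw [union_empty, Finset.disjoint_left]
    rintro c hc hc'
    obtain ⟨b, hb, rfl⟩ := mem_image.1 hc
    exact Finset.disjoint_left.1 hd (cellReflect_mem_halfPlus hL (mem_inter.1 hb).2) (mem_inter.1 hc').2

end Rows

/-! ### §2. Which corners are positive, cut, shared (axis `0`, base reflections) -/

section Classify

/-- LINK, transverse orientation: the open positive half-line `{1,…,m}` of `k = 1` consists of positive plaquettes. -/
theorem isPosPlaq_of_mem_halfPlus_one (hL : Even L) {o : Orient d} (ho : o.1.1 ≠ 0) {c : BlockIdx d L}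
    (hc : c ∈ halfPlus L 0 1) : IsPosPlaq (c, o) := by
  -- the value of `t - 1` on `ℤ/L` (inlined; the tree's `UnquenchedChessboardBoundLine.val_sub_one'` lives in the QCD cone)
  have hv : ∀ t : ZMod L, (t - 1).val = if t.val = 0 then L - 1 else t.val - 1 := fun t => by
    split_ifs with h
    · rw [(ZMod.val_eq_zero t).1 h, zero_sub, zmod_val_neg_one']
    · have ht := ZMod.val_lt t
      have h1 : t - 1 = ((t.val - 1 : ℕ) : ZMod L) := by
        rw [Nat.cast_sub (by omega), ZMod.natCast_zmod_val, Nat.cast_one]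
      rw [h1, ZMod.val_cast_of_lt (by omega)]
  rw [mem_halfPlus, hv] at hc
  obtain ⟨m, hm⟩ := hL
  unfold IsPosPlaq
  simp only [ho, ↓reduceIte]
  split_ifs at hc with h <;> omega

/-- LINK, transverse orientation: the open negative half-line reflects into positive plaquettes. -/
theorem isPosPlaq_cellReflect_of_mem_halfMinus_one (hL : Even L) {o : Orient d} (ho : o.1.1 ≠ 0) {c : BlockIdx d L}
    (hc : c ∈ halfMinus L 0 1) : IsPosPlaq (cellReflect 0 1 c, o) :=
  isPosPlaq_of_mem_halfPlus_one hL ho (cellReflect_mem_halfPlus hL hc)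

/-- LINK, in-plane orientation: the non-fixed part `{1,…,m-1}` of the closed half-line of `j = 0` is positive. -/
theorem isPosPlaq_of_mem_sRowsX (hL : Even L) {o : Orient d} (ho : o.1.1 = 0) {c : BlockIdx d L}
    (_hP : c ∈ shalfP L 0 0) (hM : c ∉ shalfM L 0 0) : IsPosPlaq (c, o) := by
  rw [mem_shalfM, sub_zero] at hM
  obtain ⟨m, hm⟩ := hL
  unfold IsPosPlaq
  simp only [ho, ↓reduceIte]
  omega

/-- LINK, in-plane orientation: the fixed part `{0, m}` consists of CUT plaquettes. -/
theorem isCrossPlaq_of_mem_sRowsF (hL : Even L) {o : Orient d} (ho : o.1.1 = 0) {c : BlockIdx d L}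
    (hP : c ∈ shalfP L 0 0) (hM : c ∈ shalfM L 0 0) : IsCrossPlaq (c, o) := by
  rw [mem_shalfP, sub_zero] at hP
  rw [mem_shalfM, sub_zero] at hM
  obtain ⟨m, hm⟩ := hL
  exact ⟨ho, by simp only; omega⟩

/-- LINK, in-plane orientation: the complement of the closed half-line reflects into positive plaquettes. -/
theorem isPosPlaq_sreflect_of_not_mem_shalfP (hL : Even L) {o : Orient d} (ho : o.1.1 = 0) {c : BlockIdx d L}
    (hP : c ∉ shalfP L 0 0) : IsPosPlaq (sreflect 0 0 c, o) := by
  have hv := val_sreflect_sub (0 : Fin d) (0 : ZMod L) c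
  rw [sub_zero, sub_zero] at hv
  rw [mem_shalfP, sub_zero] at hP
  have hlt := ZMod.val_lt (c 0)
  obtain ⟨m, hm⟩ := hL
  unfold IsPosPlaq
  simp only [ho, ↓reduceIte]
  rw [hv]
  split_ifs with h <;> omega

/-- SITE, transverse orientation: the non-fixed part `{1,…,m-1}` of the closed half-line of `j = 0` is site-positive. -/
theorem isSitePosPlaq_of_mem_sRowsX (hL : Even L) {o : Orient d} (ho : o.1.1 ≠ 0) {c : BlockIdx d L}
    (_hP : c ∈ shalfP L 0 0) (hM : c ∉ shalfM L 0 0) : IsSitePosPlaq (c, o) := by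
  rw [mem_shalfM, sub_zero] at hM
  obtain ⟨m, hm⟩ := hL
  unfold IsSitePosPlaq
  simp only [ho, ↓reduceIte]
  omega

/-- SITE, transverse orientation: the fixed part `{0, m}` consists of SHARED plaquettes. -/
theorem isSharedPlaq_of_mem_sRowsF (hL : Even L) {o : Orient d} (ho : o.1.1 ≠ 0) {c : BlockIdx d L}
    (hP : c ∈ shalfP L 0 0) (hM : c ∈ shalfM L 0 0) : IsSharedPlaq (c, o) := by
  rw [mem_shalfP, sub_zero] at hP
  rw [mem_shalfM, sub_zero] at hM
  obtain ⟨m, hm⟩ := hL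
  exact ⟨ho, by simp only; omega⟩

/-- SITE, transverse orientation: the complement of the closed half-line reflects into site-positive plaquettes. -/
theorem isSitePosPlaq_sreflect_of_not_mem_shalfP (hL : Even L) {o : Orient d} (ho : o.1.1 ≠ 0) {c : BlockIdx d L}
    (hP : c ∉ shalfP L 0 0) : IsSitePosPlaq (sreflect 0 0 c, o) := by
  have hv := val_sreflect_sub (0 : Fin d) (0 : ZMod L) c
  rw [sub_zero, sub_zero] at hv
  rw [mem_shalfP, sub_zero] at hP
  have hlt := ZMod.val_lt (c 0)
  obtain ⟨m, hm⟩ := hL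
  unfold IsSitePosPlaq
  simp only [ho, ↓reduceIte]
  rw [hv]
  split_ifs with h <;> omega

/-- SITE, in-plane orientation: the open half-line `{0,…,m-1}` of `k = 0` is site-positive. -/
theorem isSitePosPlaq_of_mem_halfPlus_zero (hL : Even L) {o : Orient d} (ho : o.1.1 = 0) {c : BlockIdx d L}
    (hc : c ∈ halfPlus L 0 0) : IsSitePosPlaq (c, o) := by
  rw [mem_halfPlus, sub_zero] at hc
  obtain ⟨m, hm⟩ := hL
  unfold IsSitePosPlaq
  simp only [ho, ↓reduceIte]
  omega

/-- SITE, in-plane orientation: the open negative half-line reflects into site-positive plaquettes. -/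
theorem isSitePosPlaq_cellReflect_of_mem_halfMinus_zero (hL : Even L) {o : Orient d} (ho : o.1.1 = 0)
    {c : BlockIdx d L} (hc : c ∈ halfMinus L 0 0) : IsSitePosPlaq (cellReflect 0 0 c, o) :=
  isSitePosPlaq_of_mem_halfPlus_zero hL ho (cellReflect_mem_halfPlus hL hc)

end Classify

/-! ### §3. Observables of site-positive and shared plaquette sets -/

section SiteObs

omit [TopologicalSpace G] [IsTopologicalGroup G] [CompactSpace G] [MeasurableSpace G] [BorelSpace G] in
/-- `F_A` lives on the closed half `0 ≤ t ≤ L/2` when every plaquette of `A` is site-positive or shared. -/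
theorem dependsOn_expObs_of_sitePos_or_shared (hL : Even L) (c : ℝ) {A : Finset (Plaquette d L)}
    (hA : ∀ q ∈ A, IsSitePosPlaq q ∨ IsSharedPlaq q) :
    DependsOn (expObs (G := G) ρ c A) ((sitePosEdges ∪ sharedEdges : Finset (Edge d L)) : Set (Edge d L)) := by
  haveI : Fact (1 < L) := ⟨by obtain ⟨r, hr⟩ := hL; have := NeZero.ne L; omega⟩
  intro U V hUV
  unfold expObs
  congr 2
  refine Finset.sum_congr rfl fun q hq => ?_
  have h : ∀ e, IsSitePosEdge e ∨ IsSharedEdge e → U e = V e := fun e he =>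
    hUV e (by rcases he with he | he <;> simp [he])
  rcases hA q hq with hq' | hq'
  · obtain ⟨h1, h2, h3, h4⟩ := edges_of_isSitePosPlaq hL hq'
    simp only [SoloBlind.plaquetteCost, plaquetteHolonomy, h _ h1, h _ h2, h _ h3, h _ h4]
  · obtain ⟨h1, h2, h3, h4⟩ := edges_of_isSharedPlaq hq'
    simp only [SoloBlind.plaquetteCost, plaquetteHolonomy, h _ (Or.inr h1), h _ (Or.inr h2), h _ (Or.inr h3),
      h _ (Or.inr h4)]

omit [NeZero L] [MeasurableSpace G] [BorelSpace G] in
/-- `F_A ∘ Θ' = F_{ϑ'A}`. -/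
theorem expObs_negReflect (hρ : Continuous ρ) (c : ℝ) (A : Finset (Plaquette d L)) (U : GaugeConfig d L G) :
    expObs ρ c A U.negReflect = expObs ρ c (A.image sitePlaqReflect) U := by
  unfold expObs
  congr 2
  rw [Finset.sum_image fun q _ q' _ h => by
    simpa [sitePlaqReflect_sitePlaqReflect] using congrArg sitePlaqReflect h]
  refine Finset.sum_congr rfl fun q _ => ?_
  rw [plaquetteCost_eq_sub_plaqRe, plaquetteCost_eq_sub_plaqRe, plaqRe_negReflect ρ hρ]

omit [TopologicalSpace G] [IsTopologicalGroup G] [CompactSpace G] [MeasurableSpace G] [BorelSpace G] in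
/-- A shared plaquette is fixed by `ϑ'` (even `L`). -/
theorem sitePlaqReflect_eq_self_of_isSharedPlaq (hL : Even L) {q : Plaquette d L} (hq : IsSharedPlaq q) :
    sitePlaqReflect q = q := by
  obtain ⟨x, ⟨⟨i, j⟩, hij⟩⟩ := q
  obtain ⟨hi, ht⟩ := hq
  simp only at hi ht
  refine Prod.ext ?_ rfl
  simp only [sitePlaqReflect, hi, ↓reduceIte]
  funext k
  by_cases hk : k = 0
  · subst hk
    apply ZMod.val_injective
    rw [val_negReflect]
    obtain ⟨m, hm⟩ := hL
    split_ifs with h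
    · exact h.symm
    · omega
  · exact negReflect_apply_of_ne _ hk

omit [MeasurableSpace G] [BorelSpace G] in
/-- The Chebyshev weight of a set of shared plaquettes is `Θ'`-invariant. -/
theorem expObs_negReflect_of_isSharedPlaq (hL : Even L) (hρ : Continuous ρ) (c : ℝ) {B : Finset (Plaquette d L)}
    (hB : ∀ q ∈ B, IsSharedPlaq q) (U : GaugeConfig d L G) : expObs ρ c B U.negReflect = expObs ρ c B U := by
  rw [expObs_negReflect ρ hρ]
  congr 1
  rw [Finset.image_congr (g := id) fun q hq => by
    simpa using sitePlaqReflect_eq_self_of_isSharedPlaq hL (hB q (Finset.mem_coe.1 hq)), Finset.image_id]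

end SiteObs

end Summit.QuantumFields.YangMills.Theorems.AllSidesChessboard

end
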